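import Literature.Computability.Complexity.IrreducibilityLLLCriterion
import HarnessLib

/-!
# The LLL degree test: does `F` have an irreducible factor of degree `≤ j`? (LLL 1982, §2–3)

Support file for the discharge of the named fact
`Literature.NumberTheory.NumberFields.nfIso_mem_P` (number-field isomorphism is in `P`;
Landau 1985, A. K. Lenstra 1983 Thm. (3.7), H. W. Lenstra 1992 §2.9). The isomorphism test
(Trager's norm method, `Literature.Computability.Complexity.nfIsomorphic_iff_of_norm_values`)
reduces the question `ℚ[X]/(p) ≅ ℚ[X]/(q)` to: *does the squarefree monic norm polynomial
`N ∈ ℤ[X]` (of degree `deg p · deg q`) have an irreducible factor over `ℚ` of degree `≤ deg q`?*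
LLL82 §3 answers such questions with one lattice reduction per `p`-adic factor: for a prime `ℓ`
with `N mod ℓ` squarefree, a monic `u ∈ ℤ[X]` lifting an irreducible factor `ū` of `N mod ℓ` to a
divisor of `N` modulo `m = ℓ^k`, and the lattice of LLL82 (2.3) in dimension `j + 1`,

  `L_j(u) = {g ∈ ℤ[X] : deg g ≤ j, u ∣ g (mod ℓ^k)}`   (tree: `LLLFactoring.factorInstance (j+1) d u m`),

the first vector `b₁` of an LLL-reduced basis is short iff the irreducible factor `h₀` of `N` with
`ū ∣ h̄₀` has degree `≤ j` (LLL82 Prop. (2.13)). This file proves the version of that test which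
the decision procedure needs, on the tree's infrastructure (`IrreducibilityLLLCriterion.lean`,
`IrreducibilityLLLResultant.lean`: the lattice, `L(factorMatrix) = L_j(u)`, Prop. (1.11) for the
first row, Hadamard/factor detection, Mignotte), for an ARBITRARY degree bound `j` and over the
COMPLETE list of local factors — so that no analogue of LLL82 Prop. (2.7) ("`h₀ ∣ b₁`") is needed:

* `degPrecision D j S = S^j · (testBound (j+1) S)^D` — the precision `ℓ^{2k}` must exceed;
  `b1SqNorm j d u m = |b₁|²` for the lattice `factorInstance (j+1) d u m`;
* `exists_irreducible_dvd_of_b1SqNorm_le` — **short vector ⇒ small factor**: if `u` (monic,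
  `0 < deg u ≤ j`) divides the monic `F` of degree `D` modulo `m ≥ 2`,
  `degPrecision D j |F|² < m²` and `|b₁|² ≤ testBound (j+1) |F|²`, then `F` has an irreducible
  factor over `ℚ` of degree `≤ j` (the polynomial `g` of `b₁` has `Res(F, g) = 0` by factor
  detection, Bremner Lemma 15.38 / LLL82 Prop. (2.7), so `gcd(F, g) ≠ 1` in `ℚ[X]`);
* `b1SqNorm_le_of_dvd` — **small factor ⇒ short vector**: if `h ∣ F`, `deg h ≤ j`, and
  `u ∣ h (mod m)` then `|b₁|² ≤ testBound (j+1) |F|²` (Mignotte + LLL82 Prop. (1.11));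
* `exists_intPoly_of_irreducible_dvd_map` — an irreducible rational factor of a monic integer
  polynomial is, up to a constant, a monic integer factor of the same degree (Gauss);
* **`exists_irreducible_degree_le_iff`** — for `ℓ` prime, `F mod ℓ` squarefree, a list `U` of monic
  lifts modulo `ℓ^k` of irreducible factors of `F mod ℓ` through which EVERY irreducible factor of
  `F mod ℓ` passes, and `degPrecision D j |F|² < ℓ^{2k}`:
  `(∃ g ∈ ℚ[X] irreducible, g ∣ F, deg g ≤ j) ↔ ∃ u ∈ U, deg u ≤ j ∧ |b₁(L_j(u))|² ≤ testBound (j+1) |F|²`.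

## References

* A. K. Lenstra, H. W. Lenstra Jr., L. Lovász, *Factoring polynomials with rational coefficients*,
  Math. Ann. 261 (1982) 515–534: (2.3), Prop. (2.5)–(2.7), Prop. (2.13), (3.1)–(3.5).
  [LenstraLenstraLovasz1982]
* M. R. Bremner, *Lattice Basis Reduction*, CRC Press 2011, §15.7 (after von zur Gathen–Gerhard,
  *Modern Computer Algebra*, §16.5): Lemma 15.38 and the factoring algorithm by short vectors.
  [Bremner2011]
* S. Landau, *Factoring polynomials over algebraic number fields*, SIAM J. Comput. 14 (1985)
  184–195, §2 (reduction of factoring over `ℚ(α)` to factoring the norm over `ℚ` by [LLL82]).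
  [Landau1985]
-/

open Polynomial Finset

namespace Literature.NumberTheory.NumberFields

open Literature.Computability.Complexity Literature.Computability.Complexity.LLLFactoring
open Literature.Algebra.EuclideanLattices

/-! ### The quantities compared by the test -/

/-- The precision of the degree-`j` test on a polynomial of degree `D` with `|F|² = S`:
`ℓ^{2k}` must exceed `S^j · (testBound (j+1) S)^D` (LLL82 (2.14)/(3.3) with `m = j`, squared,
and the cruder Mignotte constant of the tree's `testBound`). [cite: LenstraLenstraLovasz1982, Prop. (2.13) and (3.3)] -/
def degPrecision (D j : ℕ) (S : ℤ) : ℤ := S ^ j * testBound (j + 1) S ^ D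

/-- `|b₁|²` for the first row `b₁` of the LLL-reduced basis of
`L_j(u) = {g : deg g ≤ j, u ∣ g mod m}` (basis `factorInstance (j+1) d u m`, `d = deg u`).
[cite: LenstraLenstraLovasz1982, (2.3) and (3.4)] -/
noncomputable def b1SqNorm (j d : ℕ) (u : ℤ[X]) (m : ℕ) : ℤ :=
  ∑ i, (factorInstance (j + 1) d u m).lllReduce.basis ⟨0, Nat.succ_pos j⟩ i ^ 2

/-- `degPrecision` is nonnegative for `S ≥ 0`. [folklore] -/
theorem degPrecision_nonneg (D j : ℕ) {S : ℤ} (hS : 0 ≤ S) : 0 ≤ degPrecision D j S := by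
  unfold degPrecision
  exact mul_nonneg (pow_nonneg hS _) (pow_nonneg (testBound_nonneg _ hS) _)

variable {F u h : ℤ[X]} {D j d m : ℕ}

/-! ### Short vector ⇒ small factor -/

/-- Over `ℚ`, two polynomials that are not coprime share an irreducible factor. [folklore] -/
theorem exists_irreducible_dvd_dvd_of_not_isCoprime {f g : ℚ[X]} (hf : f ≠ 0)
    (hc : ¬IsCoprime f g) : ∃ π : ℚ[X], Irreducible π ∧ π ∣ f ∧ π ∣ g := by
  classical
  have hgcd : ¬IsUnit (EuclideanDomain.gcd f g) := fun hu =>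
    hc (EuclideanDomain.gcd_isUnit_iff.1 hu)
  have hgcd0 : EuclideanDomain.gcd f g ≠ 0 := fun h0 =>
    hf (EuclideanDomain.gcd_eq_zero_iff.1 h0).1
  obtain ⟨π, hπ, hπdvd⟩ := WfDvdMonoid.exists_irreducible_factor hgcd hgcd0
  exact ⟨π, hπ, hπdvd.trans (EuclideanDomain.gcd_dvd_left f g),
    hπdvd.trans (EuclideanDomain.gcd_dvd_right f g)⟩

/-- **Short vector ⇒ small factor.** Let `F ∈ ℤ[X]` be monic of degree `D > 0`, `u` monic of degree
`d` with `0 < d ≤ j`, `u ∣ F (mod m)`, `m ≥ 2`, `degPrecision D j |F|² < m²`. If the first reduced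
vector of `L_j(u)` satisfies `|b₁|² ≤ testBound (j+1) |F|²`, then `F` has an irreducible factor
over `ℚ` of degree `≤ j`: the polynomial `g ≠ 0` of `b₁` lies in `L_j(u)`, so
`|g|^D |F|^{deg g} < m` forces `Res(F, g) = 0` (factor detection), i.e. `gcd(F, g) ≠ 1` in `ℚ[X]`,
and any irreducible factor of the gcd has degree `≤ deg g ≤ j`.
[cite: LenstraLenstraLovasz1982, Prop. (2.7) and Prop. (2.13)] [cite: Bremner2011, Lemma 15.38] -/
theorem exists_irreducible_dvd_of_b1SqNorm_le (hm : 2 ≤ m) (hF : F.Monic) (hFD : F.natDegree = D)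
    (hD : 0 < D) (hu : u.Monic) (hud : u.natDegree = d) (hd : 0 < d) (hdj : d ≤ j)
    (hFu : ModDvd m u F)
    (hK : degPrecision D j (sqNorm F) < (m : ℤ) ^ 2)
    (hb : b1SqNorm j d u m ≤ testBound (j + 1) (sqNorm F)) :
    ∃ g : ℚ[X], Irreducible g ∧ g ∣ F.map (Int.castRingHom ℚ) ∧ g.natDegree ≤ j := by
  set I := factorInstance (j + 1) d u m with hIdef
  have hn0 : 0 < j + 1 := Nat.succ_pos j
  have hm0 : m ≠ 0 := by omega
  have hI : I.IsNonsingular := isNonsingular_factorInstance hu hud (by omega) hm0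
  have hS0 : 0 ≤ sqNorm F := sqNorm_nonneg F
  have hS1 : 1 ≤ sqNorm F := one_le_sqNorm_of_monic hF
  have hF0 : 0 < F.natDegree := by omega
  set b₁ : Fin (j + 1) → ℤ := I.lllReduce.basis ⟨0, hn0⟩ with hb₁
  have hNdef : b1SqNorm j d u m = ∑ i, b₁ i ^ 2 := rfl
  -- the first row as a polynomial `g ∈ L_j(u)`
  have hrow_mem : I.lllReduce.vec ⟨0, hn0⟩ ∈ I.lattice := by
    rw [← I.lllReduce_lattice]
    show I.lllReduce.vec ⟨0, hn0⟩ ∈ Submodule.span ℤ (Set.range I.lllReduce.vec)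
    exact Submodule.subset_span ⟨_, rfl⟩
  obtain ⟨g, hgn, hgmod, hgvec⟩ := exists_poly_of_mem_lattice hu hud hn0 hrow_mem
  have hgb : toVec (j + 1) g = b₁ := intVecToEuclidean_injective (j + 1) hgvec
  have hNg : b1SqNorm j d u m = sqNorm g := by rw [hNdef, ← hgb, sum_sq_toVec hgn]
  have hg0 : g ≠ 0 := by
    intro h0
    apply isNonsingular_lllReduce hI
    refine Matrix.det_eq_zero_of_row_eq_zero ⟨0, hn0⟩ fun i => ?_
    have : b₁ i = 0 := by rw [← hgb, h0, toVec_apply, coeff_zero]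
    exact this
  have hgj : g.natDegree ≤ j := by omega
  -- `|g|^D |F|^{deg g} < m`
  have hlt : rnorm g ^ F.natDegree * rnorm F ^ g.natDegree < m := by
    have hsq_le : sqNorm g ≤ testBound (j + 1) (sqNorm F) := hNg ▸ hb
    have hA : sqNorm g ^ D ≤ testBound (j + 1) (sqNorm F) ^ D :=
      pow_le_pow_left₀ (sqNorm_nonneg g) hsq_le D
    have hB : sqNorm F ^ g.natDegree ≤ sqNorm F ^ j := pow_le_pow_right₀ hS1 hgj
    have hZ : sqNorm g ^ D * sqNorm F ^ g.natDegree ≤ degPrecision D j (sqNorm F) := by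
      unfold degPrecision
      calc sqNorm g ^ D * sqNorm F ^ g.natDegree ≤ testBound (j + 1) (sqNorm F) ^ D * sqNorm F ^ j :=
            mul_le_mul hA hB (pow_nonneg hS0 _) (pow_nonneg (testBound_nonneg _ hS0) _)
        _ = sqNorm F ^ j * testBound (j + 1) (sqNorm F) ^ D := mul_comm _ _
    have h1 : (rnorm g ^ F.natDegree * rnorm F ^ g.natDegree) ^ 2 ≤ (degPrecision D j (sqNorm F) : ℝ) := by
      rw [mul_pow, ← pow_mul, ← pow_mul, mul_comm F.natDegree 2, mul_comm g.natDegree 2, pow_mul,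
        pow_mul, rnorm_sq, rnorm_sq, hFD]
      exact_mod_cast hZ
    have h2 : (degPrecision D j (sqNorm F) : ℝ) < (m : ℝ) ^ 2 := by exact_mod_cast hK
    exact lt_of_pow_lt_pow_left₀ 2 (by positivity) (h1.trans_lt h2)
  have hR := resultant_eq_zero_of_modDvd hm hu (hud ▸ hd) hF0 hFu hgmod hlt
  -- pass to `ℚ[X]`
  set φ := Int.castRingHom ℚ with hφ
  have hφi : Function.Injective φ := Int.cast_injective
  have hRq : resultant (F.map φ) (g.map φ) = 0 := by
    have := resultant_map_map F g F.natDegree g.natDegree φ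
    rw [hR, map_zero] at this
    rwa [resultant, natDegree_map_eq_of_injective hφi, natDegree_map_eq_of_injective hφi]
  have hFq0 : F.map φ ≠ 0 := fun h0 => hF.ne_zero ((Polynomial.map_eq_zero_iff hφi).1 h0)
  have hgq0 : g.map φ ≠ 0 := fun h0 => hg0 ((Polynomial.map_eq_zero_iff hφi).1 h0)
  obtain ⟨-, hnc⟩ := resultant_eq_zero_iff.1 hRq
  obtain ⟨π, hπ, hπF, hπg⟩ := exists_irreducible_dvd_dvd_of_not_isCoprime hFq0 hnc
  refine ⟨π, hπ, hπF, ?_⟩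
  have := natDegree_le_of_dvd hπg hgq0
  rw [natDegree_map_eq_of_injective hφi] at this
  omega

/-! ### Small factor ⇒ short vector -/

/-- **Small factor ⇒ short vector.** If `h ∣ F` in `ℤ[X]` (`F ≠ 0`, `h ≠ 0`), `deg h ≤ j`, and
`u ∣ h (mod m)` for a monic `u` of degree `d`, `0 < d ≤ j`, `m ≠ 0`, then the first reduced vector
of `L_j(u)` satisfies `|b₁|² ≤ testBound (j+1) |F|²`: `h` is a nonzero vector of `L_j(u)` with
`|h|² ≤ (j+1) 4^j |F|²` (Mignotte), and `|b₁|² ≤ 2^j |h|²` (LLL82 Prop. (1.11)).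
[cite: LenstraLenstraLovasz1982, Prop. (1.11), Prop. (2.13), (3.5)] -/
theorem b1SqNorm_le_of_dvd (hm0 : m ≠ 0) (hF0 : F ≠ 0) (hh0 : h ≠ 0) (hhF : h ∣ F)
    (hhj : h.natDegree ≤ j) (hu : u.Monic) (hud : u.natDegree = d) (hd : 0 < d) (hdj : d ≤ j)
    (hhu : ModDvd m u h) : b1SqNorm j d u m ≤ testBound (j + 1) (sqNorm F) := by
  set I := factorInstance (j + 1) d u m with hIdef
  have hn0 : 0 < j + 1 := Nat.succ_pos j
  have hI : I.IsNonsingular := isNonsingular_factorInstance hu hud (by omega) hm0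
  have hIn : I.n ≠ 0 := by show j + 1 ≠ 0; omega
  have hhn : h.natDegree < j + 1 := by omega
  have hmem := mem_lattice_of_modDvd (m := m) hu hud hd (by omega) hhn hhu
  have hx0 : intVecToEuclidean (j + 1) (toVec (j + 1) h) ≠ 0 := by
    intro h0
    have h1 : toVec (j + 1) h = 0 := intVecToEuclidean_injective (j + 1) (by rw [h0, map_zero])
    have : h = 0 := by rw [← ofVec_toVec hhn, h1]; simp [ofVec]
    exact hh0 this
  have hfirst : ((b1SqNorm j d u m : ℤ) : ℝ) ≤
      2 ^ (j + 1 - 1) * ‖intVecToEuclidean (j + 1) (toVec (j + 1) h)‖ ^ 2 :=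
    sum_sq_first_row_le hI hIn hmem hx0
  rw [norm_sq_intVecToEuclidean', sum_sq_toVec hhn, Nat.add_sub_cancel] at hfirst
  -- Mignotte: `|h|² ≤ (j+1) 4^j |F|²`
  have hmig : sqNorm h ≤ ((j : ℕ) + 1) * 4 ^ j * sqNorm F := sqNorm_le_of_dvd hF0 hhF hhj
  have hS0 : 0 ≤ sqNorm F := sqNorm_nonneg F
  have hmig' : sqNorm h ≤ ((j + 1 : ℕ) : ℤ) * 4 ^ (j + 1) * sqNorm F := by
    refine hmig.trans ?_
    have h41 : (4 : ℤ) ^ j ≤ 4 ^ (j + 1) := pow_le_pow_right₀ (by norm_num) (Nat.le_succ j)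
    push_cast
    gcongr
  have hle : ((b1SqNorm j d u m : ℤ) : ℝ) ≤ testBound (j + 1) (sqNorm F) := by
    refine hfirst.trans ?_
    rw [testBound, Nat.add_sub_cancel]
    push_cast
    have h2 : (0 : ℝ) ≤ 2 ^ j := by positivity
    have : (sqNorm h : ℝ) ≤ ((j + 1 : ℕ) : ℝ) * 4 ^ (j + 1) * (sqNorm F : ℝ) := by exact_mod_cast hmig'
    push_cast at this
    nlinarith
  exact_mod_cast hle

/-! ### Rational irreducible factors and integer monic factors -/

/-- **Gauss's lemma in the form used by the test**: an irreducible factor `g ∈ ℚ[X]` of the image of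
a monic `F ∈ ℤ[X]` determines a monic `h ∈ ℤ[X]` dividing `F`, with `h ⊗ ℚ` associated to `g`
(so of the same degree, at least `1`). [cite: LenstraLenstraLovasz1982, §3 (factoring in ℤ[X] vs ℚ[X], Gauss's lemma)] -/
theorem exists_intPoly_of_irreducible_dvd_map (hF : F.Monic) {g : ℚ[X]} (hg : Irreducible g)
    (hgF : g ∣ F.map (Int.castRingHom ℚ)) :
    ∃ h : ℤ[X], h.Monic ∧ h ∣ F ∧ h.natDegree = g.natDegree ∧ 0 < h.natDegree ∧
      h.map (Int.castRingHom ℚ) ∣ g := by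
  have halg : algebraMap ℤ ℚ = Int.castRingHom ℚ := rfl
  have hφi : Function.Injective (Int.castRingHom ℚ) := Int.cast_injective
  have hgF' : g ∣ F.map (algebraMap ℤ ℚ) := by rwa [halg]
  obtain ⟨h, hh⟩ := IsIntegrallyClosed.eq_map_mul_C_of_dvd (K := ℚ) hF hgF'
  rw [halg] at hh
  have hg0 : g ≠ 0 := hg.ne_zero
  have hlc : g.leadingCoeff ≠ 0 := leadingCoeff_ne_zero.2 hg0
  -- `h` is monic
  have hhm : (h.map (Int.castRingHom ℚ)).Monic := by
    have h1 := congrArg leadingCoeff hh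
    rw [leadingCoeff_mul, leadingCoeff_C] at h1
    have h2 : (h.map (Int.castRingHom ℚ)).leadingCoeff = 1 := by
      have : (h.map (Int.castRingHom ℚ)).leadingCoeff * g.leadingCoeff = 1 * g.leadingCoeff := by
        rw [h1, one_mul]
      exact mul_right_cancel₀ hlc this
    exact h2
  have hmon : h.Monic := (Function.Injective.monic_map_iff hφi).2 hhm
  -- `h.map ℚ` is associated to `g`, hence divides `F.map ℚ`, hence `h ∣ F`
  have hunit : IsUnit (C g.leadingCoeff) := isUnit_C.2 (IsUnit.mk0 _ hlc)
  have hassoc : h.map (Int.castRingHom ℚ) ∣ g := ⟨C g.leadingCoeff, hh.symm⟩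
  have hdvdq : h.map (Int.castRingHom ℚ) ∣ F.map (Int.castRingHom ℚ) := hassoc.trans hgF
  have hdvd : h ∣ F := (Polynomial.map_dvd_map (Int.castRingHom ℚ) hφi hmon).1 hdvdq
  -- degrees
  have hdeg : h.natDegree = g.natDegree := by
    have h1 := congrArg natDegree hh
    rw [natDegree_mul hhm.ne_zero (C_ne_zero.2 hlc), natDegree_C, add_zero,
      natDegree_map_eq_of_injective hφi] at h1
    exact h1
  have hpos : 0 < g.natDegree := Irreducible.natDegree_pos hg
  exact ⟨h, hmon, hdvd, hdeg, by omega, hassoc⟩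

/-! ### The test over the complete list of local factors -/

variable {ℓ k : ℕ}

/-- **The LLL degree test (LLL82 Prop. (2.13), decision form over all local factors).**
Let `F ∈ ℤ[X]` be monic of degree `D > 0`, `ℓ` a prime with `F mod ℓ` squarefree, and
`degPrecision D j |F|² < ℓ^{2k}` (`k ≥ 1`). Let `U` be a list of monic integer polynomials, each
reducing modulo `ℓ` to an irreducible polynomial and dividing `F` modulo `ℓ^k` (Berlekamp + Hensel,
LLL82 (3.1)–(3.2)), and complete: every irreducible factor of `F mod ℓ` is divisible by the
reduction of some `u ∈ U`. Then `F` has an irreducible factor over `ℚ` of degree `≤ j` iff for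
some `u ∈ U` with `deg u ≤ j` the first vector `b₁` of the LLL-reduced basis of
`L_j(u) = {g : deg g ≤ j, u ∣ g mod ℓ^k}` has `|b₁|² ≤ testBound (j+1) |F|²`.
(⇐ `exists_irreducible_dvd_of_b1SqNorm_le`; ⇒: the monic integer factor `h` under the rational
one passes through some `ū`, `u ∣ h (mod ℓ^k)` as `ū` is coprime to the cofactor of `h` in the
squarefree `F mod ℓ` (LLL82 (2.5)–(2.6)), and `b1SqNorm_le_of_dvd`.)
[cite: LenstraLenstraLovasz1982, Prop. (2.13), (3.1)–(3.5)] [cite: Landau1985, §2] -/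
theorem exists_irreducible_degree_le_iff (hℓ : ℓ.Prime) (hk : 0 < k) (hF : F.Monic)
    (hFD : F.natDegree = D) (hD : 0 < D)
    (hsq : Squarefree (F.map (Int.castRingHom (ZMod ℓ))))
    (U : List ℤ[X])
    (hU : ∀ u ∈ U, u.Monic ∧ Irreducible (u.map (Int.castRingHom (ZMod ℓ))) ∧ ModDvd (ℓ ^ k) u F)
    (hcomplete : ∀ ρ : (ZMod ℓ)[X], Irreducible ρ → ρ ∣ F.map (Int.castRingHom (ZMod ℓ)) →
      ∃ u ∈ U, u.map (Int.castRingHom (ZMod ℓ)) ∣ ρ)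
    (hK : degPrecision D j (sqNorm F) < ((ℓ ^ k : ℕ) : ℤ) ^ 2) :
    (∃ g : ℚ[X], Irreducible g ∧ g ∣ F.map (Int.castRingHom ℚ) ∧ g.natDegree ≤ j) ↔
      ∃ u ∈ U, u.natDegree ≤ j ∧
        b1SqNorm j u.natDegree u (ℓ ^ k) ≤ testBound (j + 1) (sqNorm F) := by
  haveI : Fact ℓ.Prime := ⟨hℓ⟩
  set φ := Int.castRingHom (ZMod ℓ) with hφ
  have hm2 : 2 ≤ ℓ ^ k := le_trans hℓ.two_le (Nat.le_self_pow hk.ne' ℓ)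
  have hm0 : ℓ ^ k ≠ 0 := by omega
  -- degree of `u` = degree of `ū` > 0
  have hdeg_u : ∀ u ∈ U, 0 < u.natDegree ∧ (u.map φ).natDegree = u.natDegree := fun u huU => by
    obtain ⟨hum, hui, -⟩ := hU u huU
    have h1 : (u.map φ).natDegree = u.natDegree := hum.natDegree_map φ
    exact ⟨h1 ▸ Irreducible.natDegree_pos hui, h1⟩
  constructor
  · -- (⇒)
    rintro ⟨g, hg, hgF, hgj⟩
    obtain ⟨h, hhm, hhF, hhdeg, hhpos, -⟩ := exists_intPoly_of_irreducible_dvd_map hF hg hgF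
    have hhj : h.natDegree ≤ j := by omega
    -- an irreducible factor `ρ` of `h̄`, and the `u ∈ U` through it
    have hhbm : (h.map φ).Monic := hhm.map φ
    have hhbdeg : (h.map φ).natDegree = h.natDegree := hhm.natDegree_map φ
    have hhbu : ¬IsUnit (h.map φ) := fun hun => by
      have := natDegree_eq_zero_of_isUnit hun
      omega
    obtain ⟨ρ, hρ, hρh⟩ := WfDvdMonoid.exists_irreducible_factor hhbu hhbm.ne_zero
    have hhbF : h.map φ ∣ F.map φ := Polynomial.map_dvd φ hhF
    obtain ⟨u, huU, huρ⟩ := hcomplete ρ hρ (hρh.trans hhbF)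
    obtain ⟨hum, hui, huF⟩ := hU u huU
    obtain ⟨hupos, hudeg⟩ := hdeg_u u huU
    have huh : u.map φ ∣ h.map φ := huρ.trans hρh
    have hudj : u.natDegree ≤ j := by
      have := natDegree_le_of_dvd huh hhbm.ne_zero
      omega
    refine ⟨u, huU, hudj, ?_⟩
    -- `u ∣ h (mod ℓ^k)`: invert the cofactor `w = F / h`, coprime to `ū` modulo `ℓ`
    obtain ⟨w, hFhw⟩ := hhF
    have hcop : IsCoprime (u.map φ) (w.map φ) := by
      rw [hui.coprime_iff_not_dvd]
      intro huw
      have hsq2 : u.map φ * u.map φ ∣ F.map φ := by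
        rw [hFhw, Polynomial.map_mul]; exact mul_dvd_mul huh huw
      exact hui.not_isUnit (hsq _ hsq2)
    have hhu : ModDvd (ℓ ^ k) u h :=
      modDvd_of_modDvd_mul_of_isCoprime (q := ℓ) (k := k) (by rw [← hFhw]; exact huF) hcop
    exact b1SqNorm_le_of_dvd hm0 hF.ne_zero hhm.ne_zero ⟨w, hFhw⟩ hhj hum rfl hupos hudj hhu
  · -- (⇐)
    rintro ⟨u, huU, hudj, hb⟩
    obtain ⟨hum, -, huF⟩ := hU u huU
    obtain ⟨hupos, -⟩ := hdeg_u u huU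
    have hK' : degPrecision D j (sqNorm F) < ((ℓ ^ k : ℕ) : ℤ) ^ 2 := hK
    exact exists_irreducible_dvd_of_b1SqNorm_le hm2 hF hFD hD hum rfl hupos hudj huF hK' hb

end Literature.NumberTheory.NumberFields
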